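/-
Copyright (c) 2026 the pub-hodgecm2 formalisation cell (harness21).  New file.
Origin: seat `prover-pub-hodgecm2-item6-p3-g15-0` (unit pub-hodgecm2-item6-p3, gen 15; X3-ω ∕ item-(vi) lineage), 2026-08-23.
Theorems only (one private linear-algebra helper); no definition, no named fact, no `sorry`; count-neutral.  HC_CM is not
mentioned by this file.
-/
import Literature.NumberTheory.Automorphic.Liu2021.AppendixC.Glue
import Literature.NumberTheory.Automorphic.Liu2021.Def411AsPrinted
import Literature.NumberTheory.DiophantineGeometry.AVIsogenyTateHoldsProofs
import Mathlib.LinearAlgebra.DirectSum.Finsupp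
import Mathlib.RingTheory.TensorProduct.Finite
import HarnessLib

/-!
# The summands `ω(μ, ε, χ)` of [Liu2021, Thm. 4.18]'s decomposition are ADMISSIBLE — from Thm. 4.18 AS PRINTED

[Liu2021, Def. 4.11 (`FJcycle.tex` l. 2092–2096)] calls the adèlic oscillator representation `ω(μ, ε, χ)` «an irreducible
admissible representation of `𝔾(𝔸_F^∞)`»; the tree types the sentence as the predicate `Def411AsPrinted D`
(`IsIrreducibleOrZero ∧ IsSmoothRep ∧ IsAdmissibleRep` for every `(ε, χ)`), which the COR-CM END of record displays by name
(`h411`).  This file shows that, at `μ`-ADMISSIBLE `ε` — the only indices at which any consumer uses it — the ADMISSIBILITY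
conjunct is a CONSEQUENCE of [Liu2021, Thm. 4.18] AS PRINTED (`Thm418AsPrinted D`, displayed anyway as `hLiu`) together with
the non-emptiness of `𝒜(μ)` ([Liu2021, Prop. 4.6 (1)], from [Shimura1998, Thm. 21.4] in the tree) and Mumford's finiteness of
`Hom(A, B)` (a tree THEOREM, `AbelianVariety.module_finite_hom_holds`):

* Thm. 4.18 (main clause): `Φ : Ω(μ) ⊗_{M_μ} ℂ ≃ ⊕_{(ε,χ), ε admissible} ω(μ, ε, χ)` as `ℂ[𝔾(𝔸_F^∞)]`-modules, so `ω_i^K` embeds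
  into `(Ω(μ) ⊗_{M_μ} ℂ)^K`;
* Thm. 4.18 (1): for `D_μ ∈ 𝒜(μ)` and every sufficiently small open compact `K`, `Ω(μ)^K` is the image of
  `Hom_E(A_K, A_μ)_ℚ = ℚ ⊗_ℤ Hom_E(A_K, A_μ)`, a finite-dimensional `ℚ`-space ([MumfordAV1970, §19 Thm. 3]); hence `Ω(μ)^K` is
  finite-dimensional over `M_μ`;
* invariants commute with the (free) base change `M_μ → ℂ` (§1, a basis of `ℂ` over `M_μ`), so `(Ω(μ) ⊗ ℂ)^K = Ω(μ)^K ⊗ ℂ` is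
  finite-dimensional over `ℂ`, and so is `ω_i^K`; a general open compact `K` is handled through `K ∩ K₀`.

Contents:
* §1 `Thm418Data.finiteDimensional_fixedSubmodule_rhoAt_of_thm418AsPrinted`, `Thm418Data.isAdmissibleRep_rhoAt_of_thm418AsPrinted`
  — for an ABSTRACT datum `D`, under `Thm418AsPrinted D`, an object `D_μ : D.Obj`, and the hypothesis that each `Hom_E(A_K, A_μ)_ℚ → Ω(μ)`
  has range inside a finitely generated `M_μ`-submodule (`hfg`);
* §2 `AppendixC.exists_fg_range_res_subset` — `hfg` HOLDS for every datum presented through Appendix C (`toThm418Data C R`: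
  `Hom_E(A_K, A_μ)_ℚ = ℚ ⊗_ℤ (A_{levelOf K} ⟶ A_μ)`, Mumford §19 Thm. 3), and
  `AppendixC.isAdmissibleRep_rhoAt_toThm418Data_of_thm418AsPrinted` — **`Thm418AsPrinted (toThm418Data C R)` + `D_μ ∈ 𝒜(μ)` ⟹
  `ω_i` is admissible for every admissible index `i`.**

Nothing of [Liu2021] is asserted: `Thm418AsPrinted …` and the object `D_μ` are hypotheses.

## References
* [Liu2021] Y. Liu, *Fourier–Jacobi cycles and arithmetic relative trace formula*, Camb. J. Math. 9 (2021) 1–147 = arXiv:2102.11518 —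
  Def. 4.11 (l. 2083–2097), Def. 4.16 ∕ Rem. 4.17 (l. 2219–2227), Thm. 4.18 (l. 2232–2245), Prop. 4.6 (1) (l. 1969).
* [MumfordAV1970] D. Mumford, *Abelian Varieties* (1970), §19 Thm. 3.
* [BernsteinZelevinsky1976] I. N. Bernstein, A. V. Zelevinsky, Russian Math. Surveys 31 (1976), §2.1 (admissible representations).
-/

noncomputable section

open scoped TensorProduct DirectSum
open NumberField

namespace Literature.NumberTheory.Automorphic.Liu2021

/-! ## §0 Invariants commute with a free base change (linear algebra) -/

section BaseChange

variable {R A V : Type*} [CommRing R] [CommRing A] [Algebra R A] [Module.Free R A] [AddCommGroup V] [Module R V]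

/-- If `x ∈ A ⊗_R V` is fixed by the base changes `f_k ⊗ 1` of a family of endomorphisms `f_k` of `V`, and `N ≤ V` contains every
common fixed vector of the `f_k`, then `x ∈ N ⊗_R A` (the range of `A ⊗ N → A ⊗ V`): expand `x` along an `R`-basis of `A`; each
coefficient is a common fixed vector. [folklore] -/
private theorem mem_baseChange_of_forall_baseChange_eq (N : Submodule R V) {ι : Type*} (f : ι → V →ₗ[R] V)
    (hN : ∀ v : V, (∀ k, f k v = v) → v ∈ N) (x : A ⊗[R] V) (hx : ∀ k, (f k).baseChange A x = x) :
    x ∈ N.baseChange A := by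
  classical
  let b := Module.Free.chooseBasis R A
  let e : A ⊗[R] V ≃ₗ[R] (Module.Free.ChooseBasisIndex R A →₀ V) :=
    (TensorProduct.congr b.repr (LinearEquiv.refl R V)).trans (TensorProduct.finsuppScalarLeft R V _)
  -- naturality of `e`, coefficientwise
  have hnat : ∀ (k : ι) (y : A ⊗[R] V) (i : Module.Free.ChooseBasisIndex R A),
      e ((f k).baseChange A y) i = f k (e y i) := by
    intro k y i
    induction y using TensorProduct.induction_on with
    | zero => simp
    | tmul a v =>
        simp only [e, LinearMap.baseChange_tmul, LinearEquiv.trans_apply, TensorProduct.congr_tmul, LinearEquiv.refl_apply,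
          TensorProduct.finsuppScalarLeft_apply_tmul_apply, map_smul]
    | add y z hy hz => simp only [map_add, Finsupp.add_apply, hy, hz]
  -- the coefficients of `x` are common fixed vectors
  have hcoef : ∀ i, e x i ∈ N := fun i => hN _ fun k => by
    have h := congrArg (fun w => e w i) (hx k)
    simpa only [hnat] using h
  -- `e (b i ⊗ v) = single i v`
  have hsingle : ∀ (i : Module.Free.ChooseBasisIndex R A) (v : V), e (b i ⊗ₜ[R] v) = Finsupp.single i v := by
    intro i v
    ext j
    simp only [e, LinearEquiv.trans_apply, TensorProduct.congr_tmul, LinearEquiv.refl_apply, Module.Basis.repr_self,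
      TensorProduct.finsuppScalarLeft_apply_tmul_apply, Finsupp.single_apply]
    split_ifs with h
    · subst h; exact one_smul _ _
    · exact zero_smul _ _
  -- reconstruct `x` from its coefficients
  have hx' : x = (e x).sum fun i v => b i ⊗ₜ[R] v := by
    apply e.injective
    rw [map_finsuppSum]
    conv_lhs => rw [← Finsupp.sum_single (e x)]
    refine Finsupp.sum_congr fun i _ => ?_
    rw [hsingle]
  rw [hx']
  exact Submodule.sum_mem _ fun i _ => Submodule.tmul_mem_baseChange_of_mem (b i) (hcoef i)

end BaseChange

/-! ## §1 Abstract datum: `ω_i` is admissible under Thm. 4.18 as printed -/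

namespace Thm418Data

variable {F E : Type} [Field F] [NumberField F] [IsTotallyReal F] [Field E] [NumberField E] [Algebra F E]
  [IsTotallyComplex E] [Algebra.IsQuadraticExtension F E] {D : Thm418Data F E}

/-- **Finite-dimensional `K`-fixed vectors in `ω_i` from [Liu2021, Thm. 4.18] AS PRINTED.**  For an admissible index `i = (ε, χ)`
and an open compact `K ≤ 𝔾(𝔸_F^∞)`: GIVEN `Thm418AsPrinted D` (main clause + item (1)), an object `D_μ ∈ 𝒜(μ)` and, for every open
compact `K'`, a finitely generated `M_μ`-submodule of `Ω(μ)` containing the image of `Hom_E(A_{K'}, A_μ)_ℚ → Ω(μ)` (`hfg`;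
automatic for Appendix-C data, §2), the space `ω_i^K` is finite-dimensional: `ω_i^K ≤ ω_i^{K ∩ K₀} ↪ (Ω(μ) ⊗_{M_μ} ℂ)^{K ∩ K₀}
= Ω(μ)^{K ∩ K₀} ⊗ ℂ` (item (1) at `K ∩ K₀ ≤ K₀`; invariants commute with the free base change).
[cite: Liu2021, Thm. 4.18 (main clause l. 2233–2237 and (1) l. 2239), Def. 4.11 (l. 2092–2096)] -/
theorem finiteDimensional_fixedSubmodule_rhoAt_of_thm418AsPrinted (h : Liu2021.Thm418AsPrinted D) (Dμ : D.Obj)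
    (hfg : ∀ K : Subgroup D.G, IsOpenCompact K →
      ∃ S : Submodule (fieldOfValues E D.μ) D.Ω, S.FG ∧ Set.range (D.res K Dμ) ⊆ S)
    (i : D.AdmIndex) (K : Subgroup D.G) (hK : IsOpenCompact K) :
    FiniteDimensional ℂ (fixedSubmodule (D.rhoAt i) K) := by
  classical
  obtain ⟨Φ, hΦ, h1, -, -⟩ := h
  obtain ⟨K₀, hK₀, hK₀'⟩ := h1 Dμ
  -- the open compact `K' := K ⊓ K₀ ≤ K₀`
  have hK' : IsOpenCompact (K ⊓ K₀) :=
    ⟨by rw [Subgroup.coe_inf]; exact hK.1.inter hK₀.1,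
     by rw [Subgroup.coe_inf]; exact hK₀.2.inter_left (K.isClosed_of_isOpen hK.1)⟩
  obtain ⟨-, hrange⟩ := hK₀' (K ⊓ K₀) hK' inf_le_right
  obtain ⟨S, hSfg, hSrange⟩ := hfg (K ⊓ K₀) hK'
  -- `Ω(μ)^{K'}` as an `M_μ`-submodule, finitely generated
  let N : Submodule (fieldOfValues E D.μ) D.Ω := ⨅ k : ↥(K ⊓ K₀), LinearMap.eqLocus (D.rhoΩ (k : D.G)) LinearMap.id
  have hmemN : ∀ v : D.Ω, (∀ k : ↥(K ⊓ K₀), D.rhoΩ (k : D.G) v = v) → v ∈ N := fun v hv =>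
    (Submodule.mem_iInf _).2 fun k => (LinearMap.mem_eqLocus).2 (hv k)
  have hNS : N ≤ S := fun v hv => by
    have hv' : v ∈ D.invariants (K ⊓ K₀) := fun k hk => by
      have := (Submodule.mem_iInf _).1 hv ⟨k, hk⟩
      exact (LinearMap.mem_eqLocus).1 this
    rw [← hrange] at hv'
    exact hSrange hv'
  haveI : FiniteDimensional (fieldOfValues E D.μ) S := Module.Finite.iff_fg.2 hSfg
  haveI : FiniteDimensional (fieldOfValues E D.μ) N := Submodule.finiteDimensional_of_le hNS
  -- the summand embedding `ω_i ↪ Ω(μ) ⊗ ℂ` through `Φ⁻¹`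
  let ψ : D.omegaAt i →ₗ[ℂ] ℂ ⊗[fieldOfValues E D.μ] D.Ω :=
    Φ.symm.toLinearMap ∘ₗ DirectSum.lof ℂ D.AdmIndex (fun j => D.omegaAt j) i
  have hψinj : Function.Injective ψ := Φ.symm.injective.comp (DirectSum.of_injective (β := fun j => D.omegaAt j) i)
  -- `K'`-fixed vectors of `ω_i` land in `N ⊗ ℂ`
  have hψmem : ∀ v ∈ fixedSubmodule (D.rhoAt i) (K ⊓ K₀), ψ v ∈ N.baseChange ℂ := by
    intro v hv
    rw [mem_fixedSubmodule_iff] at hv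
    refine mem_baseChange_of_forall_baseChange_eq N (fun k : ↥(K ⊓ K₀) => D.rhoΩ (k : D.G)) hmemN (ψ v) fun k => ?_
    apply Φ.injective
    have hΦψ : Φ (ψ v) = DirectSum.lof ℂ D.AdmIndex (fun j => D.omegaAt j) i v := Φ.apply_symm_apply _
    refine DFinsupp.ext fun j => ?_
    rw [hΦ (k : D.G) (ψ v) j, hΦψ, DirectSum.lof_eq_of]
    by_cases hj : j = i
    · subst hj
      rw [DirectSum.of_eq_same]
      exact hv k k.2
    · rw [DirectSum.of_eq_of_ne _ _ _ hj, map_zero]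
  -- hence `ω_i^{K'}` is finite-dimensional, and `ω_i^K ≤ ω_i^{K'}`
  haveI : FiniteDimensional ℂ (N.baseChange ℂ) := by
    unfold Submodule.baseChange
    infer_instance
  haveI : FiniteDimensional ℂ (fixedSubmodule (D.rhoAt i) (K ⊓ K₀)) :=
    FiniteDimensional.of_injective
      (LinearMap.codRestrict (N.baseChange ℂ) (ψ ∘ₗ (fixedSubmodule (D.rhoAt i) (K ⊓ K₀)).subtype) fun v => hψmem v v.2)
      fun v w hvw => Subtype.ext (hψinj (by simpa using congrArg Subtype.val hvw))
  refine Submodule.finiteDimensional_of_le (fun v hv => ?_ : fixedSubmodule (D.rhoAt i) K ≤ fixedSubmodule (D.rhoAt i) (K ⊓ K₀))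
  rw [mem_fixedSubmodule_iff] at hv ⊢
  exact fun k hk => hv k hk.1

/-- **`ω_i` is ADMISSIBLE from [Liu2021, Thm. 4.18] AS PRINTED** (+ an object of `𝒜(μ)` + `hfg`): finite-dimensional `K`-fixed vectors for
every open compact `K` — the admissibility conjunct of [Liu2021, Def. 4.11]'s «irreducible admissible» (`IsAdmissibleRep`) at every
ADMISSIBLE index, no longer posited.
[cite: Liu2021, Thm. 4.18 (main clause l. 2233–2237 and (1) l. 2239), Def. 4.11 (l. 2092–2096)] -/
theorem isAdmissibleRep_rhoAt_of_thm418AsPrinted (h : Liu2021.Thm418AsPrinted D) (Dμ : D.Obj)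
    (hfg : ∀ K : Subgroup D.G, IsOpenCompact K →
      ∃ S : Submodule (fieldOfValues E D.μ) D.Ω, S.FG ∧ Set.range (D.res K Dμ) ⊆ S)
    (i : D.AdmIndex) : IsAdmissibleRep (D.rhoAt i) :=
  fun K hK => finiteDimensional_fixedSubmodule_rhoAt_of_thm418AsPrinted h Dμ hfg i K hK

end Thm418Data

/-! ## §2 Appendix-C data: `hfg` holds (Mumford §19 Thm. 3), hence admissibility from Thm. 4.18 as printed -/

namespace AppendixC

variable {F E : Type} [Field F] [NumberField F] [IsTotallyReal F] [Field E] [NumberField E] [Algebra F E]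
  [IsTotallyComplex E] [Algebra.IsQuadraticExtension F E]
variable {P5 : PropC5Data F E} {isotropicAt : ℕ → Prop} (C : Sec42Data P5 isotropicAt) (R : Thm418Rest C)

/-- **The image of `Hom_E(A_K, A_μ)_ℚ → Ω(μ)` lies in a finitely generated `M_μ`-submodule**, for every datum presented through
Appendix C: `Hom_E(A_K, A_μ)_ℚ = ℚ ⊗_ℤ (A_{levelOf K} ⟶ A_μ)` with `A_{levelOf K} ⟶ A_μ` finitely generated over `ℤ` ([MumfordAV1970, §19
Thm. 3] = the tree theorem `AbelianVariety.module_finite_hom_holds`), and the (additive, hence `ℚ`-linear) canonical map sends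
`ℚ ⊗ {generators}` into the `M_μ`-span of finitely many vectors. [cite: Liu2021, Thm. 4.18 (1) l. 2239] [cite: MumfordAV1970, §19 Thm. 3] -/
theorem exists_fg_range_res_subset (Dμ : (toThm418Data C R).Obj) (K : Subgroup (toThm418Data C R).G) :
    ∃ S : Submodule (fieldOfValues E (toThm418Data C R).μ) (toThm418Data C R).Ω,
      S.FG ∧ Set.range ((toThm418Data C R).res K Dμ) ⊆ S := by
  classical
  haveI : Module.Finite ℤ (C.A (C.levelOf K) ⟶ R.Aμ Dμ) :=
    Literature.AlgebraicGeometry.Motives.AbelianVariety.module_finite_hom_holds _ _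
  obtain ⟨s, hs⟩ := Module.Finite.fg_top (R := ℤ) (M := (C.A (C.levelOf K) ⟶ R.Aμ Dμ))
  -- the canonical map on the REAL group `ℚ ⊗_ℤ (A_{levelOf K} ⟶ A_μ)` (rfl)
  let res : C.HomQ (C.levelOf K) (R.Aμ Dμ) →+ (toThm418Data C R).Ω := (toThm418Data C R).res K Dμ
  refine ⟨Submodule.span (fieldOfValues E (toThm418Data C R).μ)
      ((fun φ : (C.A (C.levelOf K) ⟶ R.Aμ Dμ) => res ((1 : ℚ) ⊗ₜ[ℤ] φ)) '' (s : Set _)),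
    Submodule.fg_span ((s.finite_toSet).image _), ?_⟩
  suffices hres : ∀ x : C.HomQ (C.levelOf K) (R.Aμ Dμ), res x ∈ Submodule.span (fieldOfValues E (toThm418Data C R).μ)
      ((fun φ : (C.A (C.levelOf K) ⟶ R.Aμ Dμ) => res ((1 : ℚ) ⊗ₜ[ℤ] φ)) '' (s : Set _)) by
    rintro _ ⟨x, rfl⟩
    exact hres x
  intro x
  have hx : x ∈ Submodule.span ℚ ((TensorProduct.mk ℤ ℚ (C.A (C.levelOf K) ⟶ R.Aμ Dμ) 1) '' (s : Set _)) := by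
    rw [← Submodule.baseChange_span, hs, Submodule.baseChange_top]
    trivial
  induction hx using Submodule.span_induction with
  | mem y hy =>
      obtain ⟨φ, hφ, rfl⟩ := hy
      exact Submodule.subset_span ⟨φ, hφ, rfl⟩
  | zero => rw [map_zero]; exact Submodule.zero_mem _
  | add y z _ _ hy hz => rw [map_add]; exact Submodule.add_mem _ hy hz
  | smul q y _ hy =>
      have hq := map_ratCast_smul res ℚ (fieldOfValues E (toThm418Data C R).μ) q y
      rw [Rat.cast_id] at hq
      rw [hq]
      exact Submodule.smul_mem _ _ hy

/-- **[Liu2021, Thm. 4.18] AS PRINTED ⟹ every summand `ω_i` (admissible `i`) is ADMISSIBLE**, for a datum presented through Appendix C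
and an object `D_μ ∈ 𝒜(μ)` ([Liu2021, Prop. 4.6 (1)]; in the tree from [Shimura1998, Thm. 21.4]).  The admissibility conjunct of
[Liu2021, Def. 4.11] at admissible indices is thereby DERIVED from the displayed Thm. 4.18, not posited.
[cite: Liu2021, Thm. 4.18 (main clause l. 2233–2237 and (1) l. 2239), Def. 4.11 (l. 2092–2096), Prop. 4.6 (1) (l. 1969)] [cite: MumfordAV1970, §19 Thm. 3] -/
theorem isAdmissibleRep_rhoAt_toThm418Data_of_thm418AsPrinted (h : Thm418AsPrinted (toThm418Data C R))
    (Dμ : (toThm418Data C R).Obj) (i : (toThm418Data C R).AdmIndex) : IsAdmissibleRep ((toThm418Data C R).rhoAt i) :=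
  Thm418Data.isAdmissibleRep_rhoAt_of_thm418AsPrinted h Dμ (fun K _ => exists_fg_range_res_subset C R Dμ K) i

end AppendixC

end Literature.NumberTheory.Automorphic.Liu2021

end
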